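import Mathlib
import HarnessLib
import Literature.Analysis.FluidPDE.ClassicalSolution
import Literature.Analysis.FluidPDE.ClassicalSolutionCalculus
import Literature.Analysis.FluidPDE.RapidDecayLemmas
import Summits.NavierStokesRegularity.NavierStokesRegularity.Theorems.TypeIQuarterGateScarZoomDefs
import Summits.NavierStokesRegularity.NavierStokesRegularity.Theorems.TypeIQuarterGateSliceBudgetDefs
import Summits.NavierStokesRegularity.NavierStokesRegularity.Theorems.TypeIQuarterGateScarEnvelopeTypeIScarZoom
import Summits.NavierStokesRegularity.NavierStokesRegularity.Theorems.TypeIQuarterGateScarEnvelopeTypeIABTwinScar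
import Summits.NavierStokesRegularity.NavierStokesRegularity.Theorems.TypeIQuarterGateScarEnvelopeTypeITameScarZoom
import Summits.NavierStokesRegularity.NavierStokesRegularity.Theorems.TypeIQuarterGateScarEnvelopeTypeISliceBudgetReduction

/-!
# Crux `TypeIQuarterGate.ScarEnvelopeTypeI` (stmt-NavierStokesRegularity-23843), line `slice_budget` —
# a FAILURE OF THE SLICE-WISE OCTAVE BUDGET PRODUCES SCAR VIOLATORS

Helper file (no new definitions) for the deciding stub SD `stub_sliceOctaveBudget`.  The elementary
but structural observation: if the slice-wise octave budget `OctaveBudget ν T u` FAILS under the crux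
hypotheses, the maximum points `x_k` of `|u(t_k, ·)|` on the violating closed e-annuli
`{ℓ_k ≤ |x − a| ≤ eℓ_k}` form a sequence of SCAR VIOLATORS (`ScarViolators T u`, line `scar_zoom`):
`x_k → a`, `t_k → T`, `|x_k − a| · |u(t_k, x_k)| → ∞` (the cube on the annulus is at most
`max³ · |B(a, eℓ_k)|`) and `(T − t_k)/|x_k − a|² → 0` (the Type-I rate bounds the cube by
`C₀³e³|B₁|(ℓ_k²/(T − t_k))^{3/2}`).  Consequences, all by the LANDED theorems of the two lines:

* `scarViolators_of_not_octaveBudget` — `CruxHypotheses → ¬ OctaveBudget → ScarViolators`;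
* `octaveBudget_iff_not_scarViolators` — under `CruxHypotheses`, `OctaveBudget ν T u ↔ ¬ ScarViolators T u`
  (the converse is STUB B `stub_tameScarZoom` + ESS, `noTameTwinScar'`);
* `exists_twinScarObject_inBall_of_not_octaveBudget` — `CruxHypotheses → ¬ OctaveBudget →` an
  Albritton–Barker-class TWIN-SCAR OBJECT (`exists_twinScarObject_inBall`, line `scar_zoom` S_B);
* `octaveBudget_of_noABTwinScarObject` — the thinner wall S_C′ of `scar_zoom` implies SD directly.

So the deciding stubs of the two 23843 lines COINCIDE: SD ⟺ «no scar violators» ⟺ the crux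
(`scarEnvelopeTypeI_iff_sliceOctaveBudget`), and ¬SD produces exactly the A–B twin-scar objects whose
final-time singular sets the top-time CKN tool (`…TopTimeCKN.lean`) proves `H¹`-null.

HONEST FRAMING: bookkeeping; SD, the crux `ScarEnvelopeTypeI`, its parent and the summit are OPEN and
nothing here is credited toward them.
-/

noncomputable section

-- the summit-side namespace `Summit.NavierStokesRegularity.NavierStokesRegularity.…` (single-conjunct
-- summit, D-0017) repeats a component by design; the dupNamespace linter would flag every declaration.
set_option linter.dupNamespace false

namespace Summit.NavierStokesRegularity.NavierStokesRegularity.Cruxes.ScarEnvelopeTypeI.SliceBudget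

open MeasureTheory Set Function Filter Topology TopologicalSpace Metric
open scoped NNReal ENNReal
open Literature.Analysis Literature.Analysis.FluidPDE
open Summit.NavierStokesRegularity.NavierStokesRegularity.Cruxes.ScarEnvelopeTypeI.ScarZoom
  (CruxHypotheses TameOutside ScarViolators TwinScarObject stub_scarZoom)

/-! ### The cube on an annulus is at most `max³ · |B(a, eℓ)|` -/

/-- On the e-annulus `{ℓ < |y − a| < eℓ}` the cube of a function bounded by `m ≥ 0` on the closed
annulus is at most `m³ (eℓ)³ |B₁|`. -/
theorem lintegral_annulus_cube_le {u : EuclideanSpace ℝ (Fin 3) → EuclideanSpace ℝ (Fin 3)}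
    {a : EuclideanSpace ℝ (Fin 3)} {ℓ m : ℝ} (hℓ : 0 ≤ ℓ) (hm : 0 ≤ m)
    (hbd : ∀ y, ℓ ≤ ‖y - a‖ → ‖y - a‖ ≤ Real.exp 1 * ℓ → ‖u y‖ ≤ m) :
    ∫⁻ y in {y : EuclideanSpace ℝ (Fin 3) | ℓ < ‖y - a‖ ∧ ‖y - a‖ < Real.exp 1 * ℓ}, ‖u y‖ₑ ^ (3 : ℝ)
      ≤ ENNReal.ofReal (m ^ 3 * (Real.exp 1 * ℓ) ^ 3 *
          (volume (ball (0 : EuclideanSpace ℝ (Fin 3)) 1)).toReal) := by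
  set A : Set (EuclideanSpace ℝ (Fin 3)) := {y | ℓ < ‖y - a‖ ∧ ‖y - a‖ < Real.exp 1 * ℓ} with hA
  have hAsub : A ⊆ ball a (Real.exp 1 * ℓ) := fun y hy => by
    rw [mem_ball, dist_eq_norm]; exact hy.2
  have hpt : ∀ y ∈ A, ‖u y‖ₑ ^ (3 : ℝ) ≤ ENNReal.ofReal (m ^ 3) := by
    intro y hy
    have h1 : ‖u y‖ ≤ m := hbd y hy.1.le hy.2.le
    calc ‖u y‖ₑ ^ (3 : ℝ) = ENNReal.ofReal ‖u y‖ ^ (3 : ℝ) := by rw [ofReal_norm]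
      _ ≤ ENNReal.ofReal m ^ (3 : ℝ) := ENNReal.rpow_le_rpow (ENNReal.ofReal_le_ofReal h1) (by norm_num)
      _ = ENNReal.ofReal (m ^ 3) := by
          rw [ENNReal.ofReal_rpow_of_nonneg hm (by norm_num)]
          norm_cast
  have hvolA : volume A ≤ ENNReal.ofReal ((Real.exp 1 * ℓ) ^ 3) *
      volume (ball (0 : EuclideanSpace ℝ (Fin 3)) 1) := by
    calc volume A ≤ volume (ball a (Real.exp 1 * ℓ)) := measure_mono hAsub
      _ = ENNReal.ofReal ((Real.exp 1 * ℓ) ^ 3) * volume (ball (0 : EuclideanSpace ℝ (Fin 3)) 1) := by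
          rw [Measure.addHaar_ball volume a (by positivity : (0 : ℝ) ≤ Real.exp 1 * ℓ),
            finrank_euclideanSpace_fin]
  have hV : volume (ball (0 : EuclideanSpace ℝ (Fin 3)) 1) ≠ ⊤ := measure_ball_lt_top.ne
  calc ∫⁻ y in A, ‖u y‖ₑ ^ (3 : ℝ) ≤ ∫⁻ _ in A, ENNReal.ofReal (m ^ 3) := setLIntegral_mono' ?_ hpt
    _ = ENNReal.ofReal (m ^ 3) * volume A := setLIntegral_const A _
    _ ≤ ENNReal.ofReal (m ^ 3) * (ENNReal.ofReal ((Real.exp 1 * ℓ) ^ 3) *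
          volume (ball (0 : EuclideanSpace ℝ (Fin 3)) 1)) := mul_le_mul' le_rfl hvolA
    _ = ENNReal.ofReal (m ^ 3 * (Real.exp 1 * ℓ) ^ 3 *
          (volume (ball (0 : EuclideanSpace ℝ (Fin 3)) 1)).toReal) := by
          rw [ENNReal.ofReal_mul (by positivity), ENNReal.ofReal_mul (by positivity),
            ENNReal.ofReal_toReal hV, mul_assoc]
  · -- measurability of the open annulus
    have hopen : IsOpen A := by
      have hc : Continuous fun y : EuclideanSpace ℝ (Fin 3) => ‖y - a‖ := by fun_prop
      exact (isOpen_lt continuous_const hc).inter (isOpen_lt hc continuous_const)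
    exact hopen.measurableSet

/-! ### Budget failure produces scar violators -/

/-- **A failure of the slice-wise octave budget produces scar violators.**  Under the crux hypotheses,
if `OctaveBudget ν T u` fails then `ScarViolators T u` holds: at a singular point `a` there are times
`t_k → T` and admissible radii `ℓ_k → 0` whose e-annuli carry cube `→ ∞`; the maximum points `x_k`
of `|u(t_k, ·)|` on the closed annuli satisfy `x_k → a`, `|x_k − a|·|u(t_k, x_k)| → ∞` (cube
`≤ max³·|B(a,eℓ_k)|`) and `(T − t_k)/|x_k − a|² → 0` (the Type-I rate:
cube `≤ C₀³ e³ |B₁| (ℓ_k²/(T−t_k))^{3/2}`). -/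
theorem scarViolators_of_not_octaveBudget {ν T : ℝ}
    {u : ℝ → EuclideanSpace ℝ (Fin 3) → EuclideanSpace ℝ (Fin 3)}
    {p : ℝ → EuclideanSpace ℝ (Fin 3) → ℝ}
    (hH : CruxHypotheses ν T u p) (hnot : ¬ OctaveBudget ν T u) : ScarViolators T u := by
  obtain ⟨hν, hT, hmax, -, -, hTI, -⟩ := hH
  have hsol := hmax.1
  -- ## the Type-I rate window
  obtain ⟨C, δ₀, hC0, hδ₀, hδ₀T, hrate⟩ :=
    Summit.NavierStokesRegularity.NavierStokesRegularity.Theorems.exists_typeI_rate_window hT hTI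
  -- ## the failure of the budget at some point `a`
  obtain ⟨a, -, ha⟩ : ∃ a : EuclideanSpace ℝ (Fin 3), SingularPt T u a ∧
      ∀ q δ r₀ : ℝ, 0 < δ → 0 < r₀ → ∃ t ∈ Ioo (T - δ) T, ∃ ℓ : ℝ, Real.sqrt (ν * (T - t)) ≤ ℓ ∧ ℓ ≤ r₀ ∧
        ENNReal.ofReal q <
          ∫⁻ y in {y : EuclideanSpace ℝ (Fin 3) | ℓ < ‖y - a‖ ∧ ‖y - a‖ < Real.exp 1 * ℓ},
            ‖u t y‖ₑ ^ (3 : ℝ) := by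
    by_contra hall
    push Not at hall
    apply hnot
    intro a hsa
    obtain ⟨q, δ, r₀, hδ, hr₀, hb⟩ := hall a hsa
    exact ⟨q, δ, r₀, hδ, hr₀, fun t ht ℓ h1 h2 => hb t ht ℓ h1 h2⟩
  -- ## constants and the violating data at level `k`
  set V₁ : ℝ≥0∞ := volume (ball (0 : EuclideanSpace ℝ (Fin 3)) 1) with hV₁
  have hV₁top : V₁ ≠ ⊤ := measure_ball_lt_top.ne
  have hV₁pos : 0 < V₁.toReal := ENNReal.toReal_pos (measure_ball_pos volume _ one_pos).ne' hV₁top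
  set v₁ : ℝ := V₁.toReal with hv₁
  set e3 : ℝ := Real.exp 1 ^ 3 with he3
  have he3pos : 0 < e3 := by positivity
  set δk : ℕ → ℝ := fun k => δ₀ / ((k : ℝ) + 2) with hδk
  set rk : ℕ → ℝ := fun k => 1 / ((k : ℝ) + 1) with hrk
  set qk : ℕ → ℝ := fun k => ((k : ℝ) + 1) ^ 3 * e3 * v₁ with hqk
  have hδk0 : ∀ k, 0 < δk k := fun k => by positivity
  have hδkδ₀ : ∀ k, δk k ≤ δ₀ := fun k => by
    rw [hδk]; dsimp only
    rw [div_le_iff₀ (by positivity)]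
    have hk : (0 : ℝ) ≤ (k : ℝ) := Nat.cast_nonneg k
    nlinarith
  have hrk0 : ∀ k, 0 < rk k := fun k => by positivity
  choose t ht ℓ hℓlo hℓhi hcube using fun k => ha (qk k) (δk k) (rk k) (hδk0 k) (hrk0 k)
  -- elementary facts about `t k`, `ℓ k`
  have htT : ∀ k, t k < T := fun k => (ht k).2
  have htlo : ∀ k, T - δ₀ < t k := fun k => by linarith [(ht k).1, hδkδ₀ k]
  have ht0 : ∀ k, 0 ≤ t k := fun k => by linarith [htlo k]
  have hTt : ∀ k, 0 < T - t k := fun k => sub_pos.2 (htT k)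
  have hℓpos : ∀ k, 0 < ℓ k := fun k =>
    lt_of_lt_of_le (Real.sqrt_pos.2 (mul_pos hν (hTt k))) (hℓlo k)
  -- ## the maximum point on the closed annulus
  set K : ℕ → Set (EuclideanSpace ℝ (Fin 3)) := fun k =>
    {y | ℓ k ≤ ‖y - a‖ ∧ ‖y - a‖ ≤ Real.exp 1 * ℓ k} with hK
  have hKc : ∀ k, IsCompact (K k) := by
    intro k
    have hc : Continuous fun y : EuclideanSpace ℝ (Fin 3) => ‖y - a‖ := by fun_prop
    have hclosed : IsClosed (K k) := (isClosed_le continuous_const hc).inter (isClosed_le hc continuous_const)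
    refine (isCompact_closedBall a (Real.exp 1 * ℓ k)).of_isClosed_subset hclosed ?_
    intro y hy
    rw [mem_closedBall, dist_eq_norm]
    exact hy.2
  obtain ⟨e₀, he₀⟩ := exists_norm_eq (EuclideanSpace ℝ (Fin 3)) zero_le_one
  have hKne : ∀ k, (K k).Nonempty := by
    intro k
    refine ⟨a + (ℓ k) • e₀, ?_⟩
    have hn : ‖a + (ℓ k) • e₀ - a‖ = ℓ k := by
      rw [add_sub_cancel_left, norm_smul, he₀, mul_one, Real.norm_of_nonneg (hℓpos k).le]
    refine ⟨by rw [hn], ?_⟩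
    rw [hn]
    have : (1 : ℝ) ≤ Real.exp 1 := Real.one_le_exp one_pos.le
    nlinarith [hℓpos k]
  have hcontk : ∀ k, ContinuousOn (fun y => ‖u (t k) y‖) (K k) := fun k =>
    ((hsol.smooth_velocity.continuous_slice ⟨ht0 k, htT k⟩).norm).continuousOn
  choose x hxK hxmax using fun k => (hKc k).exists_isMaxOn (hKne k) (hcontk k)
  set m : ℕ → ℝ := fun k => ‖u (t k) (x k)‖ with hm
  have hm0 : ∀ k, 0 ≤ m k := fun k => norm_nonneg _
  have hmax : ∀ k y, ℓ k ≤ ‖y - a‖ → ‖y - a‖ ≤ Real.exp 1 * ℓ k → ‖u (t k) y‖ ≤ m k :=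
    fun k y h1 h2 => hxmax k ⟨h1, h2⟩
  -- ## (a) `ℓ_k m_k > k + 1`
  have hprod : ∀ k : ℕ, (k : ℝ) + 1 < ℓ k * m k := by
    intro k
    have h1 := (hcube k).trans_le (lintegral_annulus_cube_le (hℓpos k).le (hm0 k) (hmax k))
    rw [ENNReal.ofReal_lt_ofReal_iff'] at h1
    obtain ⟨h1, -⟩ := h1
    -- `(k+1)³ e³ v₁ < m³ e³ ℓ³ v₁`
    have h2 : ((k : ℝ) + 1) ^ 3 < (ℓ k * m k) ^ 3 := by
      have h3 : ((k : ℝ) + 1) ^ 3 * (e3 * v₁) < (ℓ k * m k) ^ 3 * (e3 * v₁) := by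
        calc ((k : ℝ) + 1) ^ 3 * (e3 * v₁) = qk k := by simp only [hqk]; ring
          _ < m k ^ 3 * (Real.exp 1 * ℓ k) ^ 3 * v₁ := h1
          _ = (ℓ k * m k) ^ 3 * (e3 * v₁) := by simp only [he3]; ring
      exact lt_of_mul_lt_mul_right h3 (mul_pos he3pos hV₁pos).le
    exact lt_of_pow_lt_pow_left₀ 3 (mul_nonneg (hℓpos k).le (hm0 k)) h2
  -- ## (b) the ratio `(T − t_k)/ℓ_k² ≤ C²/(k+1)²`
  have hratio : ∀ k : ℕ, (T - t k) / ‖x k - a‖ ^ 2 ≤ C ^ 2 * (1 / ((k : ℝ) + 1)) := by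
    intro k
    have hxa : ℓ k ≤ ‖x k - a‖ := (hxK k).1
    have hr := hrate (t k) ⟨htlo k, htT k⟩ (x k)   -- √(T - t) m ≤ C
    have hk1 : (0 : ℝ) < (k : ℝ) + 1 := by positivity
    have hlm : (k : ℝ) + 1 < ℓ k * m k := hprod k
    have hlm0 : 0 < ℓ k * m k := hk1.trans hlm
    -- `(T - t) (ℓ m)² ≤ C² ℓ²`
    have h1 : (T - t k) * (ℓ k * m k) ^ 2 ≤ C ^ 2 * ℓ k ^ 2 := by
      have h2 : Real.sqrt (T - t k) * m k ≤ C := hr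
      have h3 : 0 ≤ Real.sqrt (T - t k) * m k := by positivity
      have h4 : (Real.sqrt (T - t k) * m k) ^ 2 ≤ C ^ 2 := pow_le_pow_left₀ h3 h2 2
      rw [mul_pow, Real.sq_sqrt (hTt k).le] at h4
      nlinarith [sq_nonneg (ℓ k)]
    have h5 : (T - t k) / ℓ k ^ 2 ≤ C ^ 2 / (ℓ k * m k) ^ 2 := by
      rw [div_le_div_iff₀ (pow_pos (hℓpos k) 2) (pow_pos hlm0 2)]
      linarith
    have h6 : C ^ 2 / (ℓ k * m k) ^ 2 ≤ C ^ 2 * (1 / ((k : ℝ) + 1)) := by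
      rw [mul_one_div]
      apply div_le_div_of_nonneg_left (sq_nonneg C) hk1
      nlinarith
    calc (T - t k) / ‖x k - a‖ ^ 2 ≤ (T - t k) / ℓ k ^ 2 := by
          apply div_le_div_of_nonneg_left (hTt k).le (pow_pos (hℓpos k) 2)
          exact pow_le_pow_left₀ (hℓpos k).le hxa 2
      _ ≤ C ^ 2 * (1 / ((k : ℝ) + 1)) := h5.trans h6
  -- ## assembling the violators
  refine ⟨a, x, t, fun k => ⟨ht0 k, htT k⟩, fun k => ?_, ?_, ?_, ?_, ?_⟩
  · -- `x k ≠ a`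
    intro h
    have := (hxK k).1
    rw [h, sub_self, norm_zero] at this
    linarith [hℓpos k]
  · -- `t k → T`
    have hδlim : Tendsto (fun k : ℕ => T - δk k) atTop (𝓝 T) := by
      have h1 : Tendsto (fun k : ℕ => δ₀ / ((k : ℝ) + 2)) atTop (𝓝 0) := by
        have h2 : Tendsto (fun k : ℕ => (k : ℝ) + 2) atTop atTop :=
          tendsto_natCast_atTop_atTop.atTop_add tendsto_const_nhds
        exact h2.const_div_atTop δ₀
      have := h1.const_sub T
      rwa [sub_zero] at this
    exact tendsto_of_tendsto_of_tendsto_of_le_of_le hδlim tendsto_const_nhds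
      (fun k => (ht k).1.le) (fun k => (htT k).le)
  · -- `x k → a`
    rw [tendsto_iff_norm_sub_tendsto_zero]
    have hup : Tendsto (fun k : ℕ => Real.exp 1 * (1 / ((k : ℝ) + 1))) atTop (𝓝 0) := by
      have := tendsto_one_div_add_atTop_nhds_zero_nat.const_mul (Real.exp 1)
      rwa [mul_zero] at this
    refine squeeze_zero (fun k => norm_nonneg _) (fun k => ?_) hup
    exact (hxK k).2.trans (mul_le_mul_of_nonneg_left (hℓhi k) (Real.exp_pos 1).le)
  · -- the ratio
    have hup : Tendsto (fun k : ℕ => C ^ 2 * (1 / ((k : ℝ) + 1))) atTop (𝓝 0) := by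
      have := tendsto_one_div_add_atTop_nhds_zero_nat.const_mul (C ^ 2)
      rwa [mul_zero] at this
    exact squeeze_zero (fun k => div_nonneg (hTt k).le (sq_nonneg _)) hratio hup
  · -- the product `‖x k - a‖ ‖u (t k) (x k)‖ → ∞`
    have hnat : Tendsto (fun k : ℕ => (k : ℝ) + 1) atTop atTop :=
      tendsto_natCast_atTop_atTop.atTop_add tendsto_const_nhds
    refine tendsto_atTop_mono (fun k => ?_) hnat
    calc (k : ℝ) + 1 ≤ ℓ k * m k := (hprod k).le
      _ ≤ ‖x k - a‖ * ‖u (t k) (x k)‖ := mul_le_mul_of_nonneg_right (hxK k).1 (hm0 k)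

/-! ### Consequences -/

/-- **SD ⟺ no scar violators**, under the crux hypotheses: the slice-wise octave budget holds iff
there is no scar-violator sequence.  (`←`: `scarViolators_of_not_octaveBudget`; `→`: STUB B
`stub_tameScarZoom` produces a tame twin-scar object from budget + violators, and ESS forbids it,
`noTameTwinScar'`.) -/
theorem octaveBudget_iff_not_scarViolators {ν T : ℝ}
    {u : ℝ → EuclideanSpace ℝ (Fin 3) → EuclideanSpace ℝ (Fin 3)}
    {p : ℝ → EuclideanSpace ℝ (Fin 3) → ℝ} (hH : CruxHypotheses ν T u p) :
    OctaveBudget ν T u ↔ ¬ ScarViolators T u := by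
  constructor
  · intro hB hV
    obtain ⟨M, v, hv⟩ := stub_tameScarZoom ν T u p hH hB hV
    exact noTameTwinScar' M v hv
  · intro hV
    by_contra hB
    exact hV (scarViolators_of_not_octaveBudget hH hB)

/-- **¬SD ⟹ an Albritton–Barker-class twin-scar object**: if the slice-wise octave budget fails under
the crux hypotheses, the scar violators it produces zoom (line `scar_zoom`'s S_B,
`exists_twinScarObject_inBall`) to a Type-I ancient mild TWIN-SCAR OBJECT lying, with some pressure,
in Albritton–Barker's class on every ball — whose final-time singular set is `H¹`-null by the top-time
CKN tool (`hausdorffMeasure_topSingular_eq_zero_of_typeIBound`). -/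
theorem exists_twinScarObject_inBall_of_not_octaveBudget {ν T : ℝ}
    {u : ℝ → EuclideanSpace ℝ (Fin 3) → EuclideanSpace ℝ (Fin 3)}
    {p : ℝ → EuclideanSpace ℝ (Fin 3) → ℝ} (hH : CruxHypotheses ν T u p)
    (hnot : ¬ OctaveBudget ν T u) :
    ∃ (M : ℝ) (v : ℝ → EuclideanSpace ℝ (Fin 3) → EuclideanSpace ℝ (Fin 3))
      (P : ℝ → EuclideanSpace ℝ (Fin 3) → ℝ), TwinScarObject M v ∧
        ∀ R : ℝ, 0 < R → IsSuitableWeakSolutionInBall R 0 v P :=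
  exists_twinScarObject_inBall ν T u p hH (scarViolators_of_not_octaveBudget hH hnot)

/-- **S_C′ ⟹ SD directly**: if no twin-scar object lies (with some pressure) in Albritton–Barker's class
on every ball, the slice-wise octave budget holds for every crux-class blow-up. -/
theorem octaveBudget_of_noABTwinScarObject
    (hSC : ∀ (M : ℝ) (v : ℝ → EuclideanSpace ℝ (Fin 3) → EuclideanSpace ℝ (Fin 3))
      (P : ℝ → EuclideanSpace ℝ (Fin 3) → ℝ),
      TwinScarObject M v → ¬ ∀ R : ℝ, 0 < R → IsSuitableWeakSolutionInBall R 0 v P)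
    {ν T : ℝ} {u : ℝ → EuclideanSpace ℝ (Fin 3) → EuclideanSpace ℝ (Fin 3)}
    {p : ℝ → EuclideanSpace ℝ (Fin 3) → ℝ} (hH : CruxHypotheses ν T u p) :
    OctaveBudget ν T u := by
  by_contra hnot
  obtain ⟨M, v, P, hv, hball⟩ := exists_twinScarObject_inBall_of_not_octaveBudget hH hnot
  exact hSC M v P hv hball

end Summit.NavierStokesRegularity.NavierStokesRegularity.Cruxes.ScarEnvelopeTypeI.SliceBudget

end
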